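import Summits.QuantumFields.YangMills.Theorems.LangevinControlUVFemtoCurvatureSkewnessCRatioTransportDefsF
import Summits.QuantumFields.YangMills.Theorems.LangevinControlUVFemtoCurvatureSkewnessCDominatedDescent

/-!
# Crux `FemtoCurvatureSkewnessC` (stmt-QuantumFields-16205), line `ratio-transport`: bridges from the promotable forms (F) to the stubs

Lead `prover-line-stmt-QuantumFields-16205-c2-0` (line lead, cycle 3, 2026-08-16), companion proof file of the vocabulary (F)
`LangevinControlUVFemtoCurvatureSkewnessCRatioTransportDefsF.lean`, integrating the kernel-checked scratch work of the three
stub-workers of wave 3 (stubs E_v, E_s, A of skeleton v4.2 — all `stub-blocked`: no tree / Literature fact behind any of them).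
Theorems only, no `sorry`, nothing posited; pure real analysis (Heine–Cantor on a compact rectangle, guard transfer, `rpow` algebra)
(this file: engine side).

* § Transfer — `volumeModulus_of_dominated`, `volumeCauchy_of_dominated`, `separationModulus_of_dominated`: the qualitative transports
  see a unit map only through the femto guard.
* § Profile — `volumeModulus_of_profile`, `volumeCauchy_of_profile`, `separationModulus_of_profile`, `cutoffTwoEnded_of_profile`
  (ONE continuous profile `Φ(n·a, n/L)` on `[0, ℓ] × [0, 1/8]` gives all three qualitative transports and, for any block factor `M ≥ 1`,
  the two-ended cutoff transport); `profileEngine_engineQ : ProfileEngine → RatioTransportEngineQ` — with the landed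
  `femtoCurvatureSkewnessC_of_engineQ`, `ProfileEngine → Anchors → FemtoCurvatureSkewnessC`.
* The anchor side (tree dominance ⇒ anchors; `MarkedCouplingDominance → Anchors`; anchors NECESSARY) is the sibling file
  `LangevinControlUVFemtoCurvatureSkewnessCTreeDominanceBridges.lean`.
-/

set_option autoImplicit false

noncomputable section

namespace Summit.QuantumFields.YangMills.Cruxes.FemtoCurvatureSkewnessC.RatioTransport

open MeasureTheory Filter Topology
open scoped BigOperators
open Literature.MathematicalPhysics.QuantumFieldTheory
open Summit.QuantumFields.YangMills.Theorems.FemtoCurvatureSkewness.Negative (kappa3 TwoPointPackage)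

/-! ## § Transfer — the qualitative transports see the unit map only through the femto guard -/

section Transfer

variable {G : Type} [Group G] [TopologicalSpace G] [IsTopologicalGroup G] [CompactSpace G]
  [MeasurableSpace G] [BorelSpace G]

/-- **The volume modulus transfers to any dominating map** (femto boxes of `a₀` below `ℓ/K` are femto boxes of `a` below `ℓ`). -/
theorem volumeModulus_of_dominated (r : LatticeRep G) {a a₀ : ℝ → ℝ} (h : VolumeModulus r a) (hdom : Dominated a a₀) :
    VolumeModulus r a₀ := by
  obtain ⟨K, β₃, hK, hKβ⟩ := hdom
  intro ε hε
  obtain ⟨βv, ℓv, η, hℓv, hη, H⟩ := h ε hε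
  refine ⟨max βv β₃, ℓv / K, η, div_pos hℓv hK, hη, fun L L' _ _ β n hβ hL hn h8 hle hLη => ?_⟩
  exact H L L' β n (le_of_max_le_left hβ) (guard_of_dominated hK hKβ (le_of_max_le_right hβ) hL) hn h8 hle hLη

/-- **The large-aspect-ratio Cauchy property transfers to any dominating map.** -/
theorem volumeCauchy_of_dominated (r : LatticeRep G) {a a₀ : ℝ → ℝ} (h : VolumeCauchy r a) (hdom : Dominated a a₀) :
    VolumeCauchy r a₀ := by
  obtain ⟨K, β₃, hK, hKβ⟩ := hdom
  intro ε hε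
  obtain ⟨βv, ℓv, K', hℓv, hK', H⟩ := h ε hε
  refine ⟨max βv β₃, ℓv / K, K', div_pos hℓv hK, hK', fun L L' _ _ β n hβ hL hn hKn hle => ?_⟩
  exact H L L' β n (le_of_max_le_left hβ) (guard_of_dominated hK hKβ (le_of_max_le_right hβ) hL) hn hKn hle

/-- **The separation modulus transfers to any dominating map.** -/
theorem separationModulus_of_dominated (r : LatticeRep G) {a a₀ : ℝ → ℝ} (h : SeparationModulus r a)
    (hdom : Dominated a a₀) : SeparationModulus r a₀ := by
  obtain ⟨K, β₃, hK, hKβ⟩ := hdom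
  intro ε hε
  obtain ⟨βs, ℓs, η, hℓs, hη, H⟩ := h ε hε
  refine ⟨max βs β₃, ℓs / K, η, div_pos hℓs hK, hη, fun L _ β n n' hβ hL hn hnn' hη' h8 => ?_⟩
  exact H L β n n' (le_of_max_le_left hβ) (guard_of_dominated hK hKβ (le_of_max_le_right hβ) hL) hn hnn' hη' h8

end Transfer

/-! ## § Profile — one continuous profile on the compact rectangle gives all three qualitative transports and the two-ended transport -/

section Profile

variable {G : Type} [Group G] [TopologicalSpace G] [IsTopologicalGroup G] [CompactSpace G]
  [MeasurableSpace G] [BorelSpace G]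

omit [Group G] [TopologicalSpace G] [IsTopologicalGroup G] [CompactSpace G] [MeasurableSpace G] [BorelSpace G] in
/-- The parameter point `(n·a(β), n/L)` of an admissible `(L, β, n)` lies in the rectangle `[0, ℓ] × [0, 1/8]`. -/
theorem mem_rect {a : ℝ → ℝ} (hpos : ∀ β, 0 < a β) {ℓ : ℝ} {L : ℕ} {β : ℝ} {n : ℕ}
    (hL : (L : ℝ) * a β ≤ ℓ) (h8 : 8 * n ≤ L) (hLpos : (0 : ℝ) < L) :
    ((n : ℝ) * a β, (n : ℝ) / L) ∈ Set.Icc (0 : ℝ) ℓ ×ˢ Set.Icc (0 : ℝ) 8⁻¹ := by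
  have hnL : (n : ℝ) ≤ L := by exact_mod_cast (show n ≤ L by omega)
  have h8r : 8 * (n : ℝ) ≤ L := by exact_mod_cast h8
  refine Set.mk_mem_prod ⟨?_, ?_⟩ ⟨?_, ?_⟩
  · exact mul_nonneg (Nat.cast_nonneg n) (hpos β).le
  · exact le_trans (mul_le_mul_of_nonneg_right hnL (hpos β).le) hL
  · exact div_nonneg (Nat.cast_nonneg n) hLpos.le
  · rw [div_le_iff₀ hLpos, show (8 : ℝ)⁻¹ * L = L / 8 by ring, le_div_iff₀ (by norm_num : (0 : ℝ) < 8)]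
    linarith

/-- **Femto continuum profile ⇒ volume modulus** (Heine–Cantor on the rectangle; `η := δ(ε/3)`): a relative enlargement of the box by
`η` moves the aspect fraction `n/L` by at most `η/8 < δ` at the same physical separation.  (Wave-3 worker, stub E_v.) -/
theorem volumeModulus_of_profile (r : LatticeRep G) {a : ℝ → ℝ} (hpos : ∀ β, 0 < a β)
    (h : FemtoContinuumProfile r a) : VolumeModulus r a := by
  obtain ⟨Φ, ℓ, hℓ, hΦ, happrox⟩ := h
  intro ε hε
  have hε3 : 0 < ε / 3 := by positivity
  obtain ⟨βv, hβv⟩ := happrox (ε / 3) hε3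
  have hK : IsCompact (Set.Icc (0 : ℝ) ℓ ×ˢ Set.Icc (0 : ℝ) 8⁻¹) := isCompact_Icc.prod isCompact_Icc
  obtain ⟨δ, hδ, hδΦ⟩ :=
    Metric.uniformContinuousOn_iff.1 (hK.uniformContinuousOn_of_continuous hΦ) (ε / 3) hε3
  refine ⟨βv, ℓ, δ, hℓ, hδ, ?_⟩
  intro L L' _ _ β n hβ hL hn h8 hle hLη
  have hLpos : (0 : ℝ) < L := by exact_mod_cast (show 0 < L by omega)
  have hL'pos : (0 : ℝ) < L' := by exact_mod_cast (show 0 < L' by omega)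
  have hL' : (L' : ℝ) * a β ≤ ℓ :=
    le_trans (mul_le_mul_of_nonneg_right (by exact_mod_cast hle) (hpos β).le) hL
  have h8L : 8 * n ≤ L := h8.trans hle
  have hx := mem_rect hpos hL h8L hLpos
  have hy := mem_rect hpos hL' h8 hL'pos
  have hθ : (n : ℝ) / L ≤ 8⁻¹ := (Set.mem_prod.1 hx).2.2
  have hnL : (n : ℝ) / L ≤ (n : ℝ) / L' :=
    div_le_div_of_nonneg_left (Nat.cast_nonneg n) hL'pos (by exact_mod_cast hle)
  have h2 : (n : ℝ) / L' ≤ (1 + δ) * ((n : ℝ) / L) := by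
    rw [div_le_iff₀ hL'pos, show (1 + δ) * ((n : ℝ) / L) * L' = (n : ℝ) * ((1 + δ) * L') / L by ring,
      le_div_iff₀ hLpos]
    exact mul_le_mul_of_nonneg_left hLη (Nat.cast_nonneg n)
  have hdist : dist ((n : ℝ) * a β, (n : ℝ) / L) ((n : ℝ) * a β, (n : ℝ) / (L' : ℝ)) < δ := by
    rw [Prod.dist_eq]
    refine max_lt (by simpa using hδ) ?_
    show |(n : ℝ) / L - (n : ℝ) / L'| < δ
    rw [abs_sub_comm, abs_of_nonneg (sub_nonneg.2 hnL)]
    calc (n : ℝ) / L' - (n : ℝ) / L ≤ δ * ((n : ℝ) / L) := by linarith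
      _ ≤ δ * 8⁻¹ := mul_le_mul_of_nonneg_left hθ hδ.le
      _ < δ := by linarith
  have e1 := hβv L β n hβ hL hn h8L
  have e2 := hβv L' β n hβ hL' hn h8
  have e3 := hδΦ _ hx _ hy hdist
  rw [Real.dist_eq] at e3
  have hsplit : skewRatioT r L β n - skewRatioT r L' β n =
      (skewRatioT r L β n - Φ ((n : ℝ) * a β, (n : ℝ) / L)) +
        (Φ ((n : ℝ) * a β, (n : ℝ) / L) - Φ ((n : ℝ) * a β, (n : ℝ) / (L' : ℝ))) +
        (Φ ((n : ℝ) * a β, (n : ℝ) / (L' : ℝ)) - skewRatioT r L' β n) := by ring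
  rw [hsplit]
  refine (abs_add_three _ _ _).trans ?_
  rw [abs_sub_comm (Φ _) (skewRatioT r L' β n)]
  linarith

/-- **Femto continuum profile ⇒ large-aspect-ratio Cauchy property** (Heine–Cantor; `K := max 8 K₁`, `1/δ(ε/3) < K₁`): two boxes of
aspect ratio `≥ K` have aspect fractions `≤ 1/K < δ` at the same physical separation.  (Wave-3 worker, stub E_v.) -/
theorem volumeCauchy_of_profile (r : LatticeRep G) {a : ℝ → ℝ} (hpos : ∀ β, 0 < a β)
    (h : FemtoContinuumProfile r a) : VolumeCauchy r a := by
  obtain ⟨Φ, ℓ, hℓ, hΦ, happrox⟩ := h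
  intro ε hε
  have hε3 : 0 < ε / 3 := by positivity
  obtain ⟨βv, hβv⟩ := happrox (ε / 3) hε3
  have hK : IsCompact (Set.Icc (0 : ℝ) ℓ ×ˢ Set.Icc (0 : ℝ) 8⁻¹) := isCompact_Icc.prod isCompact_Icc
  obtain ⟨δ, hδ, hδΦ⟩ :=
    Metric.uniformContinuousOn_iff.1 (hK.uniformContinuousOn_of_continuous hΦ) (ε / 3) hε3
  obtain ⟨K₁, hK₁⟩ := exists_nat_gt (1 / δ)
  refine ⟨βv, ℓ, max 8 K₁, hℓ, le_max_left _ _, ?_⟩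
  intro L L' _ _ β n hβ hL hn hKn hle
  have h8 : 8 * n ≤ L' := le_trans (Nat.mul_le_mul_right n (le_max_left 8 K₁)) hKn
  have hLpos : (0 : ℝ) < L := by exact_mod_cast (show 0 < L by omega)
  have hL'pos : (0 : ℝ) < L' := by exact_mod_cast (show 0 < L' by omega)
  have hK₁pos : (0 : ℝ) < K₁ := lt_trans (by positivity) hK₁
  have hL' : (L' : ℝ) * a β ≤ ℓ :=
    le_trans (mul_le_mul_of_nonneg_right (by exact_mod_cast hle) (hpos β).le) hL
  have h8L : 8 * n ≤ L := h8.trans hle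
  have hx := mem_rect hpos hL h8L hLpos
  have hy := mem_rect hpos hL' h8 hL'pos
  have hnL : (n : ℝ) / L ≤ (n : ℝ) / L' :=
    div_le_div_of_nonneg_left (Nat.cast_nonneg n) hL'pos (by exact_mod_cast hle)
  have hnK : n * K₁ ≤ L' :=
    le_trans (Nat.mul_le_mul_left n (le_max_right 8 K₁)) (by rw [Nat.mul_comm]; exact hKn)
  have hnL' : (n : ℝ) / L' ≤ 1 / K₁ := by
    rw [div_le_div_iff₀ hL'pos hK₁pos, one_mul]
    exact_mod_cast hnK
  have h1δ : 1 / (K₁ : ℝ) < δ :=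
    (div_lt_iff₀ hK₁pos).2 (by rw [mul_comm]; exact (div_lt_iff₀ hδ).1 hK₁)
  have hθ0 : 0 ≤ (n : ℝ) / L := (Set.mem_prod.1 hx).2.1
  have hdist : dist ((n : ℝ) * a β, (n : ℝ) / L) ((n : ℝ) * a β, (n : ℝ) / (L' : ℝ)) < δ := by
    rw [Prod.dist_eq]
    refine max_lt (by simpa using hδ) ?_
    show |(n : ℝ) / L - (n : ℝ) / L'| < δ
    rw [abs_sub_comm, abs_of_nonneg (sub_nonneg.2 hnL)]
    calc (n : ℝ) / L' - (n : ℝ) / L ≤ (n : ℝ) / L' := by linarith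
      _ ≤ 1 / K₁ := hnL'
      _ < δ := h1δ
  have e1 := hβv L β n hβ hL hn h8L
  have e2 := hβv L' β n hβ hL' hn h8
  have e3 := hδΦ _ hx _ hy hdist
  rw [Real.dist_eq] at e3
  have hsplit : skewRatioT r L β n - skewRatioT r L' β n =
      (skewRatioT r L β n - Φ ((n : ℝ) * a β, (n : ℝ) / L)) +
        (Φ ((n : ℝ) * a β, (n : ℝ) / L) - Φ ((n : ℝ) * a β, (n : ℝ) / (L' : ℝ))) +
        (Φ ((n : ℝ) * a β, (n : ℝ) / (L' : ℝ)) - skewRatioT r L' β n) := by ring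
  rw [hsplit]
  refine (abs_add_three _ _ _).trans ?_
  rw [abs_sub_comm (Φ _) (skewRatioT r L' β n)]
  linarith

/-- **Femto continuum profile ⇒ separation modulus** (Heine–Cantor; `η := δ/(ℓ+1)`): a relative enlargement of the separation by `η`
moves the physical separation by `≤ η·ℓ/8 < δ` and the aspect fraction by `≤ η/8 < δ`. -/
theorem separationModulus_of_profile (r : LatticeRep G) {a : ℝ → ℝ} (hpos : ∀ β, 0 < a β)
    (h : FemtoContinuumProfile r a) : SeparationModulus r a := by
  obtain ⟨Φ, ℓ, hℓ, hΦ, happrox⟩ := h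
  intro ε hε
  have hε3 : 0 < ε / 3 := by positivity
  obtain ⟨βv, hβv⟩ := happrox (ε / 3) hε3
  have hK : IsCompact (Set.Icc (0 : ℝ) ℓ ×ˢ Set.Icc (0 : ℝ) 8⁻¹) := isCompact_Icc.prod isCompact_Icc
  obtain ⟨δ, hδ, hδΦ⟩ :=
    Metric.uniformContinuousOn_iff.1 (hK.uniformContinuousOn_of_continuous hΦ) (ε / 3) hε3
  have hℓ1 : 0 < ℓ + 1 := by linarith
  refine ⟨βv, ℓ, δ / (ℓ + 1), hℓ, div_pos hδ hℓ1, ?_⟩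
  intro L _ β n n' hβ hL hn hnn' hη h8'
  have h8 : 8 * n ≤ L := le_trans (Nat.mul_le_mul_left 8 hnn') h8'
  have hLpos : (0 : ℝ) < L := by exact_mod_cast (show 0 < L by omega)
  have haβ : 0 < a β := hpos β
  have hx := mem_rect hpos hL h8 hLpos
  have hy := mem_rect hpos hL h8' hLpos
  have hηle : δ / (ℓ + 1) ≤ δ := div_le_self hδ.le (by linarith)
  have hd : ((n' : ℝ) - n) ≤ δ / (ℓ + 1) * n := by
    have : (n' : ℝ) ≤ (1 + δ / (ℓ + 1)) * n := hη
    linarith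
  have hd0 : 0 ≤ (n' : ℝ) - n := by rw [sub_nonneg]; exact_mod_cast hnn'
  have hn8 : (n : ℝ) ≤ L / 8 := by
    rw [le_div_iff₀ (by norm_num : (0 : ℝ) < 8)]
    have : (8 * n : ℝ) ≤ L := by exact_mod_cast h8
    linarith
  -- physical separations differ by `< δ`
  have ht : |(n : ℝ) * a β - n' * a β| < δ := by
    rw [abs_sub_comm, ← sub_mul, abs_of_nonneg (mul_nonneg hd0 haβ.le)]
    calc ((n' : ℝ) - n) * a β ≤ δ / (ℓ + 1) * n * a β := mul_le_mul_of_nonneg_right hd haβ.le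
      _ ≤ δ / (ℓ + 1) * (L / 8) * a β := by gcongr
      _ = δ / (ℓ + 1) * ((L : ℝ) * a β) / 8 := by ring
      _ ≤ δ / (ℓ + 1) * ℓ / 8 := by gcongr
      _ < δ := by
          have h1 : δ / (ℓ + 1) * ℓ < δ := by
            rw [div_mul_eq_mul_div, div_lt_iff₀ hℓ1]; nlinarith
          have h2 : 0 ≤ δ / (ℓ + 1) * ℓ := by positivity
          linarith
  -- aspect fractions differ by `< δ`
  have hθ : |(n : ℝ) / L - n' / L| < δ := by
    rw [abs_sub_comm, ← sub_div, abs_of_nonneg (div_nonneg hd0 hLpos.le), div_lt_iff₀ hLpos]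
    calc (n' : ℝ) - n ≤ δ / (ℓ + 1) * n := hd
      _ ≤ δ * (L / 8) := by gcongr
      _ < δ * L := by nlinarith
  have hdist : dist ((n : ℝ) * a β, (n : ℝ) / L) ((n' : ℝ) * a β, (n' : ℝ) / L) < δ := by
    rw [Prod.dist_eq]
    exact max_lt ht hθ
  have e1 := hβv L β n hβ hL hn h8
  have e2 := hβv L β n' hβ hL (hn.trans hnn') h8'
  have e3 := hδΦ _ hx _ hy hdist
  rw [Real.dist_eq] at e3
  have hsplit : skewRatioT r L β n' - skewRatioT r L β n =
      (skewRatioT r L β n' - Φ ((n' : ℝ) * a β, (n' : ℝ) / L)) +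
        (Φ ((n' : ℝ) * a β, (n' : ℝ) / L) - Φ ((n : ℝ) * a β, (n : ℝ) / L)) +
        (Φ ((n : ℝ) * a β, (n : ℝ) / L) - skewRatioT r L β n) := by ring
  rw [hsplit]
  refine (abs_add_three _ _ _).trans ?_
  rw [abs_sub_comm (Φ ((n' : ℝ) * a β, (n' : ℝ) / L)) (Φ _), abs_sub_comm (Φ _) (skewRatioT r L β n)]
  linarith

/-- **Femto continuum profile ⇒ two-ended cutoff transport, any block factor `M ≥ 1`** (no continuity used): the fine end
`(M^k L₀, β, M^k n₀)` and the coarse end `(L₀, β', n₀)` of an `a`-chain (`a β' = M^k a β`) have the SAME physical separation and the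
SAME aspect fraction, so both are within `δ/2` of the same profile value. -/
theorem cutoffTwoEnded_of_profile (r : LatticeRep G) {a : ℝ → ℝ} (h : FemtoContinuumProfile r a) {M : ℕ} (hM : 1 ≤ M) :
    CutoffTwoEnded r a M := by
  obtain ⟨Φ, ℓ, hℓ, -, happrox⟩ := h
  intro δ hδ
  obtain ⟨βv, hβv⟩ := happrox (δ / 2) (by positivity)
  refine ⟨βv, ℓ, 1, hℓ, le_rfl, ?_⟩
  intro L L₀ _ _ k n₀ β β' hL hn₀ h8 hβc hβ'β hfem haβ'
  have hMk : 0 < M ^ k := Nat.pow_pos (by omega)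
  have hMkr : (0 : ℝ) < (M : ℝ) ^ k := by exact_mod_cast hMk
  have hn' : 1 ≤ M ^ k * n₀ := Nat.mul_pos hMk (by omega)
  have h8' : 8 * (M ^ k * n₀) ≤ L := by
    rw [hL]
    calc 8 * (M ^ k * n₀) = M ^ k * (8 * n₀) := by ring
      _ ≤ M ^ k * L₀ := Nat.mul_le_mul_left _ h8
  have hfem₀ : (L₀ : ℝ) * a β' ≤ ℓ := by
    have : (L₀ : ℝ) * a β' = (L : ℝ) * a β := by rw [haβ', hL]; push_cast; ring
    rw [this]; exact hfem
  have e1 := hβv L β (M ^ k * n₀) (hβc.trans hβ'β) hfem hn' h8'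
  have e2 := hβv L₀ β' n₀ hβc hfem₀ (by omega) h8
  -- the two parameter points coincide
  have ht : ((M ^ k * n₀ : ℕ) : ℝ) * a β = (n₀ : ℝ) * a β' := by rw [haβ']; push_cast; ring
  have hθ : ((M ^ k * n₀ : ℕ) : ℝ) / (L : ℝ) = (n₀ : ℝ) / (L₀ : ℝ) := by
    have hL₀pos : (0 : ℝ) < L₀ := by exact_mod_cast (show 0 < L₀ by omega)
    rw [hL]; push_cast
    rw [mul_comm ((M : ℝ) ^ k) (n₀ : ℝ), mul_comm ((M : ℝ) ^ k) (L₀ : ℝ), mul_div_mul_right _ _ hMkr.ne']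
  rw [ht, hθ] at e1
  have hsplit : skewRatioT r L β (M ^ k * n₀) - skewRatioT r L₀ β' n₀ =
      (skewRatioT r L β (M ^ k * n₀) - Φ ((n₀ : ℝ) * a β', (n₀ : ℝ) / L₀)) +
        (Φ ((n₀ : ℝ) * a β', (n₀ : ℝ) / L₀) - skewRatioT r L₀ β' n₀) := by ring
  rw [hsplit]
  refine (abs_add_le _ _).trans ?_
  rw [abs_sub_comm (Φ _) (skewRatioT r L₀ β' n₀)]
  linarith

end Profile

/-- **Profile engine ⇒ the merged v4.2 engine statement** (`E_c` with block factor `2` along the engine's map; `E_v`, `E_s` transferred to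
the hypothesis map's boxes by domination). -/
theorem profileEngine_engineQ (h : ProfileEngine) : RatioTransportEngineQ := by
  intro G _ _ _ _ _ _ hG r a₀ ha₀ hP₀
  obtain ⟨a, ha, hpos, hdom, hprof⟩ := h G hG r a₀ ha₀ hP₀
  exact ⟨⟨2, le_rfl, a, ha, hpos, hdom, cutoffTwoEnded_of_profile r hprof (by norm_num)⟩,
    ⟨volumeModulus_of_dominated r (volumeModulus_of_profile r hpos hprof) hdom,
      volumeCauchy_of_dominated r (volumeCauchy_of_profile r hpos hprof) hdom⟩,
    separationModulus_of_dominated r (separationModulus_of_profile r hpos hprof) hdom⟩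
end Summit.QuantumFields.YangMills.Cruxes.FemtoCurvatureSkewnessC.RatioTransport

end
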